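import Literature.AnabelianGeometry.EtaleTheta.SettingModelSlice2Wreath
import HarnessLib

/-!
# (L3′) slice 2, file 7/13 — the axis is pinned: `s(i) = εi`, `σ̂`-normalisation

Part of the (L3′) slice-2 chain (abc-iut-L6-t19; FILING SHAPE derived from scratch v5 `Slice2TheoremR2ScratchV5.lean`
551b982286441a66 by the edits E1–E4/D1–D3/H1–H2 of FILING-PLAN-SLICE2.md 9643c7e42a42ad24 and the OPTION-L re-cut of §F v1.19gz (W):
one definitions file + twelve theorem files).  Classical profinite group theory about OUR semi-synthetic `F₂hatT`; the objects and laws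
are those of the one-sentence residual of record (cf. [EtTh] §1, §2 for the role they play there — nothing of [EtTh]/[IUTchII]/[IUTchIII]
in print is asserted; no side on [IUTchIII] Cor. 3.12; MORATORIUM (E): no application to `hext_at_iff_exists_f2hatAut_of_eq`).
-/

noncomputable section

open scoped Pointwise

namespace Literature.AnabelianGeometry.EtaleTheta.SettingModel.Slice2

open Literature.AnabelianGeometry.EtaleTheta.SettingModel
open Literature.AnabelianGeometry.EtaleTheta (ZHatLevel.level ZHatLevel.levelChar)
open Literature.AnabelianGeometry.SemiGraphs (GQp)
open Literature.AnabelianGeometry.AbsoluteAnabelian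
open Literature.AnabelianGeometry.AbsoluteAnabelian.AbsTopII
open _root_.Topology

/-! ## §11 (S2–S5, KERNEL ROUTE, continued) THE AXIS IS PINNED: `s(i) = εi`, exactness, `e_t = 1`, `Ψ′ = ψ_ε` on
every axis cusp group, on `B` and on `A`; `Û′ = Û` -/

section AxisPinning

variable {p : ℕ} [Fact p.Prime] {l : ℕ+} {U₀ : Subgroup (GQp p)} {m : ℕ+} {f' : F₂hatT} {Ψ : F₂hatT → F₂hatT}

/-- `η(i+1) = η(i)·η(1)`. [cite: RibesZalesskii2010, Thm 2.7.1] -/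
theorem eta_succ (i : ℤ) : ZHatLevel.eta (i + 1) = ZHatLevel.eta i * zOne := by
  rw [ZHatLevel.eta_eq_zpow, zpow_add_one, ← ZHatLevel.eta_eq_zpow]

/-- `η(i) η(j) = η(i+j)`. [cite: RibesZalesskii2010, Thm 2.7.1] -/
theorem eta_mul_eta (i j : ℤ) : ZHatLevel.eta i * ZHatLevel.eta j = ZHatLevel.eta (i + j) := by
  rw [ZHatLevel.eta_eq_zpow, ZHatLevel.eta_eq_zpow j, ZHatLevel.eta_eq_zpow (i + j), zpow_add]

/-- `η(i)⁻¹ = η(−i)`. [cite: RibesZalesskii2010, Thm 2.7.1] -/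
theorem eta_inv (i : ℤ) : (ZHatLevel.eta i)⁻¹ = ZHatLevel.eta (-i) := by
  rw [ZHatLevel.eta_eq_zpow, ZHatLevel.eta_eq_zpow (-i), zpow_neg]

/-- `η(1)^m η(1)^m = η(2m)`. [cite: RibesZalesskii2010, Thm 2.7.1] -/
theorem zOne_pow_mul_zOne_pow (m : ℕ) : zOne ^ m * zOne ^ m = ZHatLevel.eta ((2 * m : ℕ) : ℤ) := by
  rw [zOne, ZHatLevel.eta_eq_zpow ((2 * m : ℕ) : ℤ), ← pow_add, ← two_mul, zpow_natCast]

/-- `(β_s^u)^n = β_s^{u^n}`. [cite: MochizukiEtTh2009, §1 p.12] -/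
theorem betaPow_pow (s u : ZH) (n : ℕ) : betaPow s u ^ n = betaPow s (u ^ n) := by
  rw [betaPow_eq_powHat, betaPow_eq_powHat, map_pow]

/-- `β_s^t = β_s^{t'} → t = t'`. [cite: MochizukiEtTh2009, §1 p.12] -/
theorem betaPow_right_injective (s : ZH) {t t' : ZH} (h : betaPow s t = betaPow s t') : t = t' := by
  rw [betaPow, betaPow] at h
  exact bPow_injective (mul_left_cancel (mul_right_cancel h))

/-- Distinct lines meet trivially: `β_s^w = β_{s'}^{w'}` with `s ≠ s'` forces `β_s^w = 1`. [cite: MochizukiSemiAnbd2006, Ex. 2.10 p.31] -/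
theorem betaPow_eq_one_of_eq_of_ne {s s' w w' : ZH} (hne : s ≠ s') (h : betaPow s w = betaPow s' w') :
    betaPow s w = 1 := by
  by_contra h1
  have hw : bPow w ≠ 1 := fun h0 => h1 ((betaPow_eq_one_iff s w).2 ((bPow_eq_one_iff w).1 h0))
  have hw' : bPow w' ≠ 1 := fun h0 => h1 (by rw [h, (betaPow_eq_one_iff s' w').2 ((bPow_eq_one_iff w').1 h0)])
  exact hne (eq_of_betaPow_commute hw hw' (by rw [h]))

/-- `d_{1,t} = b^t` (`s = 1`, i.e. the integer `0`). [cite: MochizukiEtTh2009, §1 p.12] -/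
theorem dElt_one (t : ZH) : dElt 1 t = bPow t := by
  rw [dElt, map_one, aPow_one, inv_one, mul_one, mul_one]

/-- **`d_{s·η1,t} = d_{s,t} β_{s·η1}^{2t}`** (PL3-R2 S2: `c_{x+1} = c_x β_{x+1}^{2t}`). [cite: MochizukiEtTh2009, §1 p.12] -/
theorem dElt_succ (s t : ZH) : dElt (s * zOne) t = dElt s t * betaPow (s * zOne) (t * t) := by
  rw [dElt, dElt, betaPow, map_mul (powHat (ea * bPow (t * t))), aPow_mul, aPow_zOne, zOne, ← iotaZ_one_eq,
    powHat_iotaZ_one]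
  try group

/-- The image line of a cusp is determined by any ONE of its non-trivial images. [cite: MochizukiEtTh2009, §1 p.12] -/
theorem Residual.line_eq_of_psi_eq (h : Residual p l U₀ m f' Ψ) [U₀.FiniteIndex] (i : ℤ) {u s μ : ZH}
    (hu : betaPow (ZHatLevel.eta i) u ∈ Uhat l) (hne : bPow u ≠ 1) (hμ : bPow μ ≠ 1)
    (hψ : Ψ (betaPow (ZHatLevel.eta i) u) = betaPow s μ) : s = h.line i := by
  obtain ⟨μ', hμ', hne'⟩ := h.psi_cusp i hu hne
  rw [hψ] at hμ'
  exact eq_of_betaPow_commute hμ hne' (by rw [hμ'])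

/-- **NEIGHBOURING LINES DIFFER BY `±1`**: `s(i+1) = s(i) ± 1` — from (★) for the two cusps `κ_i, κ_{i+1} ∈ V_i`,
(★★), the wreath lemma (W), and injectivity of lines. [cite: MochizukiEtTh2009, §1 p.12] -/
theorem Residual.line_succ (h : Residual p l U₀ m f' Ψ) [U₀.FiniteIndex] (i : ℤ) :
    h.line (i + 1) = h.line i * zOne ∨ h.line (i + 1) = h.line i * zOne⁻¹ := by
  set t : ZH := zOne ^ (m : ℕ) with ht
  have htl : ZHatLevel.level l t = 1 := level_pow_eq_one_of_dvd h.dvd zOne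
  obtain ⟨e, he⟩ := h.dlaw zOne
  rw [← ht] at he
  -- the two cusps in `V_i`
  obtain ⟨μ₁, hψ₁, hμ₁⟩ := h.psi_cusp i (kappa_mem_Uhat i) (bPow_eta_l_ne_one l)
  obtain ⟨μ₂, hψ₂, hμ₂⟩ := h.psi_cusp (i + 1) (kappa_mem_Uhat (i + 1)) (bPow_eta_l_ne_one l)
  obtain ⟨w₁, hw₁⟩ := h.exists_psi_dElt htl (kappa_mem_Uhat i)
    (conj_betaPow_mem_vertGp (ZHatLevel.eta i) _) hμ₁ hψ₁ he
  have hP : (aPow (ZHatLevel.eta i))⁻¹ * betaPow (ZHatLevel.eta (i + 1)) (ZHatLevel.eta (l : ℤ)) *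
      aPow (ZHatLevel.eta i) ∈ DehnTwist.vertGp := by
    rw [eta_succ]; exact conj_betaPow_succ_mem_vertGp _ _
  obtain ⟨w₂, hw₂⟩ := h.exists_psi_dElt htl (kappa_mem_Uhat (i + 1)) hP hμ₂ hψ₂ he
  -- (★★) and (W)
  have heq : dElt (h.line i) t * betaPow (h.line i) w₁ =
      dElt (h.line (i + 1)) t * betaPow (h.line (i + 1)) w₂ := by
    have := hw₁.symm.trans hw₂
    rw [mul_assoc, mul_assoc] at this
    exact mul_left_cancel this
  have hW := wreath_input_of_dElt_eq heq
  rw [ht, zOne_pow_mul_zOne_pow] at hW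
  set δ := (h.line (i + 1))⁻¹ * h.line i with hδ
  rcases eq_of_cElt_eq (by positivity : 0 < 2 * (m : ℕ)) hW with h0 | h1 | h1
  · -- `δ = 1`: equal lines, contradiction with injectivity
    exfalso
    have : h.line (i + 1) = h.line i := by
      rw [hδ, inv_mul_eq_one] at h0; exact h0
    have := h.line_injective this
    omega
  · right
    rw [hδ, inv_mul_eq_iff_eq_mul] at h1
    rw [h1, zOne, mul_inv_cancel_right]
  · left
    rw [hδ, inv_mul_eq_iff_eq_mul] at h1
    rw [h1, ← eta_inv, zOne, mul_assoc, inv_mul_cancel, mul_one]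

/-- `s(1) = ±1`. [cite: MochizukiEtTh2009, §1 p.12] -/
theorem Residual.line_one_cases (h : Residual p l U₀ m f' Ψ) [U₀.FiniteIndex] :
    h.line 1 = zOne ∨ h.line 1 = zOne⁻¹ := by
  have := h.line_succ 0
  rw [zero_add, h.line_zero, one_mul, one_mul] at this
  exact this

/-- **The lines of `σ̂ ∘ Ψ′` are the inverses**: `s_{σ̂Ψ′}(i) = s(i)⁻¹`. [cite: MochizukiEtTh2009, §2 p.36] -/
theorem Residual.sigmaHat_comp_line (h : Residual p l U₀ m f' Ψ) [U₀.FiniteIndex] (i : ℤ) :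
    h.sigmaHat_comp.line i = (h.line i)⁻¹ := by
  obtain ⟨μ, hψ, hμ⟩ := h.psi_cusp i (kappa_mem_Uhat i) (bPow_eta_l_ne_one l)
  have hμ' : bPow μ⁻¹ ≠ 1 := by rw [map_inv, Ne, inv_eq_one]; exact hμ
  have e : (fun x => sigmaHat (Ψ x)) (betaPow (ZHatLevel.eta i) (ZHatLevel.eta (l : ℤ))) =
      betaPow (h.line i)⁻¹ μ⁻¹ := by
    simp only [hψ, sigmaHat_betaPow]
  exact (h.sigmaHat_comp.line_eq_of_psi_eq i (kappa_mem_Uhat i) (bPow_eta_l_ne_one l) hμ' e).symm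

/-- **UNIFORM SIGN**: if `s(1) = 1` then `s(i) = i` for every `i ∈ ℤ` (two inductions; at each step the wrong
neighbour is `s(i∓1)`, excluded by injectivity). [cite: MochizukiEtTh2009, §1 p.12] -/
theorem Residual.line_eq_eta (h : Residual p l U₀ m f' Ψ) [U₀.FiniteIndex]
    (h1 : h.line 1 = zOne) (i : ℤ) : h.line i = ZHatLevel.eta i := by
  -- upward: P n := s(n) = η n ∧ s(n+1) = η(n+1)
  have up : ∀ n : ℕ, h.line n = ZHatLevel.eta n ∧ h.line (n + 1) = ZHatLevel.eta (n + 1) := by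
    intro n
    induction n with
    | zero =>
      refine ⟨?_, ?_⟩
      · rw [Nat.cast_zero, h.line_zero, ZHatLevel.eta_eq_zpow, zpow_zero]
      · rw [Nat.cast_zero, zero_add, h1]
    | succ n ih =>
      obtain ⟨ih0, ih1⟩ := ih
      refine ⟨by exact_mod_cast ih1, ?_⟩
      push_cast
      rcases h.line_succ (n + 1) with e | e
      · rw [e, ih1, ← eta_succ]
      · exfalso
        rw [ih1, zOne, eta_inv, eta_mul_eta, show (n : ℤ) + 1 + -1 = n by ring, ← ih0] at e
        have := h.line_injective e
        omega
  -- downward: Q n := s(−n) = η(−n) ∧ s(−n+1) = η(−n+1)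
  have down : ∀ n : ℕ, h.line (-(n : ℤ)) = ZHatLevel.eta (-(n : ℤ)) ∧
      h.line (-(n : ℤ) + 1) = ZHatLevel.eta (-(n : ℤ) + 1) := by
    intro n
    induction n with
    | zero =>
      refine ⟨?_, ?_⟩
      · rw [Nat.cast_zero, neg_zero, h.line_zero, ZHatLevel.eta_eq_zpow, zpow_zero]
      · rw [Nat.cast_zero, neg_zero, zero_add, h1]
    | succ n ih =>
      obtain ⟨ih0, ih1⟩ := ih
      have e2 : -((n + 1 : ℕ) : ℤ) + 1 = -(n : ℤ) := by push_cast; ring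
      refine ⟨?_, by rw [e2]; exact ih0⟩
      rcases h.line_succ (-((n + 1 : ℕ) : ℤ)) with e | e
      · -- `s(−n) = s(−n−1)·η1` ⇒ `s(−n−1) = η(−n−1)`
        rw [e2, ih0] at e
        have : h.line (-((n + 1 : ℕ) : ℤ)) = ZHatLevel.eta (-(n : ℤ)) * (ZHatLevel.eta 1)⁻¹ := by
          rw [eq_mul_inv_iff_mul_eq]; exact e.symm
        rw [this, eta_inv, eta_mul_eta]; congr 1; push_cast; ring
      · exfalso
        rw [e2, ih0] at e
        -- e : η(−n) = s(−n−1) η1⁻¹ ⇒ s(−n−1) = η(−n+1) = s(−n+1)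
        have e' : h.line (-((n + 1 : ℕ) : ℤ)) = ZHatLevel.eta (-(n : ℤ) + 1) := by
          rw [eq_mul_inv_iff_mul_eq, ← eta_succ] at e; exact e.symm
        rw [← ih1] at e'
        have := h.line_injective e'
        omega
  rcases Int.eq_nat_or_neg i with ⟨n, rfl | rfl⟩
  · exact (up n).1
  · exact (down n).1

end AxisPinning

end Literature.AnabelianGeometry.EtaleTheta.SettingModel.Slice2

end
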